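import Summits.QuantumFields.YangMills.Theorems.BalabanUVNodesK0AxComplexGaussianRatioFrame
import Literature.MathematicalPhysics.QuantumFieldTheory.Balaban1983to89.B2Eq228Conditioning

/-!
# K0⁷ — THE RECORD-SIDE FORMAT NAMES: THE (R-b) BRIDGE, GENERIC HALF — `gaussRatioC` AT A REAL PRECISION IS THE EXPECTATION UNDER THE SOCKET's PROBABILITY GAUSSIAN `gaussProb`
# (◆ CRIT-1 g38 rider (R-b) on ✓`…FluctRatioC` (nodeO STATUS 2026-08-31 l.5536): «the real-point bridge … a THEOREM when the Gaussian carrier builds, never a letter»; SUMMON-CONDITIONS v9 item 5′(b))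

Cell `ym-nodeO-ideate` ∕ `ym-balaban-port`, DEFINER seat `ym-nodeO-def-1` (gen 39); `--kind proof --supports stmt-QuantumFields-20541 --as helper`; count-neutral.
[I] = [Balaban1987RG1].

WHY.  Two carriers of the SAME Gaussian expectation live in the tree: the complex-parameter, Lebesgue-reference ratio ✓`gaussRatioC χ M E` (ed.26 — the object ◇ lens-1's CGRS∕N4-R bricks
✓`…K0AxComplexGaussianRatio*` are proved on, with their real currency `quadFormR`∕`gaussNormR`) and the PROBABILITY Gaussian `B2Eq228Conditioning.gaussProb M` of `B13GaugeDevices.gaussWeight∕gaussNorm`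
(the measure under ✓`B12Eq216GaussianCarrier.gaussFieldPush`, i.e. under the stage-1b∕2 socket ✓`recordFluctMeasure` → ✓`recordFluctInt`).  This file JOINS the two currencies: it reuses ◇'s
✓`quadC_map_ofReal`∕✓`gaussNormC_map_ofReal` BY NAME and adds the identification with `gaussProb` — unconditionally (both sides share the junk `0` when the normalisation vanishes).

WHAT THIS FILE PROVES (ns `…K0RecordFormatNames`; 0 def):
* (reusing ◇'s ✓`quadFormR_eq_dotProduct` from `…ComplexGaussianRatioFrame`) `gaussWeight_eq_exp_quadFormR`; `gaussNormR_eq_gaussNorm : gaussNormR A = gaussNorm A` (◇'s real currency = `B13GaugeDevices`');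
* `gaussIntC_map_ofReal : gaussIntC χ (A.map (↑)) (↑∘E) = ↑(∫ x, gaussWeight A x * (χ x * Real.exp (E x)))`;
* ★★ `gaussRatioC_map_ofReal_eq_integral_gaussProb : gaussRatioC χ (A.map (↑)) (fun x => (E x : ℂ)) = ↑(∫ x, χ x * Real.exp (E x) ∂(gaussProb A))` — THE BRIDGE (✓`integral_gaussProb`).
The record half (`(recordFluctDataOf …).integral` = this at `A := recordPreckLoc …`, `χ ∘ Φ = chiRem`, via ✓`integral_gaussFieldPush`) is the next proof leaf.

HONEST FRAMING.  A change-of-currency identity (bookkeeping); NOTHING of Bałaban asserted, ported or discharged; `stub_FE` (XXL) ∕ `stub_P0C` OPEN, ⟨27930⟩ OPEN (1∕3); K0⁷ ∕ K0ᴬ ∕ K1ᴬ ∕ K3ᴬ OPEN;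
NODE O 0∕1; COUNT 8∕28 · K 1∕4 UNMOVED; finite `𝕋⁴_{L^K}` at fixed ε — NOT continuum ∕ ℝ⁴ ∕ OS; **the Yang–Mills mass gap (Clay) is NOT proved by any of this.**  No `sorry`; standard axioms.
-/

noncomputable section

open scoped BigOperators
open MeasureTheory

namespace Summit.QuantumFields.YangMills.Theorems.K0RecordFormatNames

open Literature.MathematicalPhysics.QuantumFieldTheory.Balaban1983to89
open B2Eq228Conditioning (gaussProb integral_gaussProb)
open B13GaugeDevices (gaussWeight gaussNorm gaussInt gaussMean)
open Summit.QuantumFields.YangMills.Theorems.K0AxComplexGaussianRatio (quadFormR gaussNormR quadC_map_ofReal gaussNormC_map_ofReal quadFormR_eq_dotProduct)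
open _root_.Matrix

variable {ι : Type} [Fintype ι]

/-- `gaussWeight A x = exp(−½·quadFormR A x)`. [cite: Balaban1987RG1, (2.12) p.268 (bookkeeping)] -/
theorem gaussWeight_eq_exp_quadFormR (A : Matrix ι ι ℝ) (x : ι → ℝ) : gaussWeight A x = Real.exp (-(1 / 2 : ℝ) * quadFormR A x) := by
  rw [gaussWeight, quadFormR_eq_dotProduct, neg_mul]

/-- ◇'s real normalisation IS `B13GaugeDevices.gaussNorm`: `gaussNormR A = gaussNorm A`. [cite: Balaban1987RG1, (2.12) p.268 (bookkeeping)] -/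
theorem gaussNormR_eq_gaussNorm (A : Matrix ι ι ℝ) : gaussNormR A = gaussNorm A := by
  unfold gaussNormR gaussNorm
  exact integral_congr_ae (Filter.Eventually.of_forall fun x => (gaussWeight_eq_exp_quadFormR A x).symm)

/-- The integrand of `gaussIntC` at a real precision and a real exponent is a real number, cast. [cite: Balaban1987RG1, (2.12) p.268 (bookkeeping)] -/
theorem gaussIntC_integrand_map_ofReal (A : Matrix ι ι ℝ) (χ : (ι → ℝ) → ℝ) (E : (ι → ℝ) → ℝ) (x : ι → ℝ) :
    (χ x : ℂ) * Complex.exp (-(1 / 2 : ℂ) * quadC (A.map ((↑) : ℝ → ℂ)) x + (E x : ℂ))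
      = ((gaussWeight A x * (χ x * Real.exp (E x)) : ℝ) : ℂ) := by
  rw [quadC_map_ofReal, gaussWeight_eq_exp_quadFormR]
  have h : -(1 / 2 : ℂ) * (quadFormR A x : ℂ) + (E x : ℂ) = (((-(1 / 2 : ℝ) * quadFormR A x) + E x : ℝ) : ℂ) := by
    push_cast; ring
  rw [h, ← Complex.ofReal_exp, ← Complex.ofReal_mul, Real.exp_add]
  push_cast; ring

/-- `gaussIntC` at a real precision ∕ real exponent is the real Gaussian integral of `B13GaugeDevices`, cast. [cite: Balaban1987RG1, (2.12) p.268 (bookkeeping)] -/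
theorem gaussIntC_map_ofReal (A : Matrix ι ι ℝ) (χ : (ι → ℝ) → ℝ) (E : (ι → ℝ) → ℝ) :
    gaussIntC χ (A.map ((↑) : ℝ → ℂ)) (fun x => (E x : ℂ)) = ((∫ x, gaussWeight A x * (χ x * Real.exp (E x)) : ℝ) : ℂ) := by
  unfold gaussIntC
  simp_rw [gaussIntC_integrand_map_ofReal]
  exact integral_complex_ofReal

/-- ★★ **THE (R-b) BRIDGE, GENERIC HALF**: at a REAL precision `A` and a real exponent `E`, the complex Lebesgue-reference ratio IS the expectation under the probability Gaussian `gaussProb A`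
(the measure of the stage-1b∕2 socket): `gaussRatioC χ ↑A ↑E = ↑(∫ χ·e^{E} dμ_{A⁻¹})` — unconditionally (both sides share the junk `0` when the normalisation vanishes).
[cite: Balaban1987RG1, (2.12)–(2.13) p.268] -/
theorem gaussRatioC_map_ofReal_eq_integral_gaussProb (A : Matrix ι ι ℝ) (χ : (ι → ℝ) → ℝ) (E : (ι → ℝ) → ℝ) :
    gaussRatioC χ (A.map ((↑) : ℝ → ℂ)) (fun x => (E x : ℂ)) = ((∫ x, χ x * Real.exp (E x) ∂(gaussProb A) : ℝ) : ℂ) := by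
  rw [gaussRatioC, gaussIntC_map_ofReal, gaussNormC_map_ofReal, gaussNormR_eq_gaussNorm, ← Complex.ofReal_div, integral_gaussProb, gaussMean, gaussInt,
    smul_eq_mul, div_eq_inv_mul]
  simp only [smul_eq_mul]

end Summit.QuantumFields.YangMills.Theorems.K0RecordFormatNames

end
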